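/-
Origin: expansion seat `planner-pub-hodgecm-mc-axioms-1-g14-0`, handover #W28 2026-08-20T15:53:55Z md5 39aff478d53d (PKG 766ec0bc7b2d → 39aff478d53d; 302 l.; MECHANICAL (iib-R) rewrite v3.1 of the PKG file as it stands (18 token edits; rules R1x1+RX[h₂']x17)) (`HOME/mc/pub-hodgecm-mc-axioms-1-g14/revendor/kit-r55/stage55/HodgeCM/Model/ArchKTypeOfSlotRecChar34.lean`, md5 39aff478d53d, 302 lines);
landed by the gen-22 packager (p-g22) in gate run 55 REPLACES the earlier landed copy of `HodgeCM/Model/ArchKTypeOfSlotRecChar34.lean` (seat copy carried the packager Origin header of an earlier run (stripped)).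
-/
/-
Copyright (c) 2026. Released under Apache 2.0 license as described in the file LICENSE.
Cell pub-hodgecm, MODEL layer (construction prover mc-carch-1, gen 4), BINDER-OWNERS row 12 `C` for the CONJUGATED-plane lines k = 2, 3:
the literal-slot G terms at binder-2's vacuum exponent tuple OF RECORD — the (34) twin of RUN-41 `ArchKTypeOfSlotRecChar`.
-/
import Summits.HodgeConjecture.HodgeCM.Model.ArchKTypeOfSlotChar34_2
import Summits.HodgeConjecture.HodgeCM.Model.ArchKTypeOfSlotRecChar

/-!
# Lines 2 and 3 at the exponent of record: `lineVacExponentsTwo/Three`, `archKTypeOfSlotTwoRecG/ThreeRecG`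

For the conjugated-plane lines `d₂ = dW' c.D 0`, `d₃ = dW' c.D 1` (splittings `hGR₂/hGR₃`): the four sign facts `lineSign_two/three` (the line
sign at `ι₁` is free: #CA15 `line_hs₁W_of_real`, so NO plane-sign hypothesis), the tuples of record
`lineVacExponentsTwo V c hGR₂ eR eS` / `…Three V c hGR₃ eR eS := placeVacExponents … (lineSign_…) (slot datum)` with `e_P − e_Q = 1` and (K)
`cmBlockRepAt_κ_tensorPi_lineVacExponentsTwo/Three`, and the G terms `archKTypeOfSlotTwoRecG/ThreeRecG` (inputs {`hlevel`, `arch₀`, `harch`,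
`hfin`, `hsec`, `hχ`} + positivity data `eR eS`) with rows 14/15 (`…_twistG`, `…_of_embedding_eqG`).
Nothing is cited and nothing is minted; 0 records, 0 `def … : Prop`.
-/

set_option autoImplicit false

noncomputable section

open Filter Topology Complex
open NumberField NumberField.InfinitePlace NumberField.mixedEmbedding IsDedekindDomain MeasureTheory
open scoped Matrix TensorProduct Classical SchwartzMap
open MulAction
open Literature.Geometry.ComplexHyperbolic.BallModel (U21 x₀ stabilizerEquivK21)
open Literature.NumberTheory.Automorphic.U21 (K21 matA sclD pPlus pPlus_apply)
open Literature.AlgebraicGeometry.HodgeTheory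
open Literature.AlgebraicGeometry.ShimuraVarieties Literature.AlgebraicGeometry.ShimuraVarieties.BallForms
open Literature.NumberTheory.Automorphic Literature.NumberTheory.Weil1964
open Literature.RepresentationTheory.HeisenbergGroup (polar Heisenberg symplecticGroup ofSymplectic)
open Literature.RepresentationTheory.KonnoKonno2007 Literature.RepresentationTheory.KonnoKonno2007.RealDualPair
open Literature.NumberTheory.GelbartRogawski1991 Literature.NumberTheory.GelbartRogawski1991.UnitaryDualPair
open Literature.Analysis.SegalBargmann Literature.Analysis.Distribution
open Literature.NumberTheory.Automorphic.PicardCM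
open HodgeCM.Adelic HodgeCM.PerL34 HodgeCM.Model.HypCensus HodgeCM.Model.SupplyInstance HodgeCM.Model.ArchSideTerm

namespace HodgeCM.Model
section Record

variable (hHD : exists_isReal_hodgeModel) (hI : hodgePQ_independent_of_hodgeModel)
  (h₁ : BallQuotientUniformised)  (h₃ : CMAbelianVarietyRealised)

variable {L : CMField} {ι₁ : L →+* ℂ} (V : HermSpace3 L ι₁) (c : SeesawCtx L)
  (hGR : (cmSplittingDatum (L : Type) finProdFinEquiv (frameD V) (frameD_real V) (frameD_ne V) (dW c.D) (dW_real c.D)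
    (dW_ne c.D)).CompatibleSplitting)
  (hGR₀ : (cmSplittingDatum (L : Type) (e₁) (frameD V) (frameD_real V) (frameD_ne V) (lineVec (L : Type) (dW c.D 0))
    (fun _ => dW_real c.D 0) (fun _ => dW_ne c.D 0)).CompatibleSplitting)
  (hGR₁ : (cmSplittingDatum (L : Type) (e₁) (frameD V) (frameD_real V) (frameD_ne V) (lineVec (L : Type) (dW c.D 1))
    (fun _ => dW_real c.D 1) (fun _ => dW_ne c.D 1)).CompatibleSplitting)
  (hGR₂ : (cmSplittingDatum (L : Type) (e₁) (frameD V) (frameD_real V) (frameD_ne V) (lineVec (L : Type) (dW' c.D 0))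
    (fun _ => dW'_real c.D 0) (fun _ => dW'_ne c.D 0)).CompatibleSplitting)
  (hGR₃ : (cmSplittingDatum (L : Type) (e₁) (frameD V) (frameD_real V) (frameD_ne V) (lineVec (L : Type) (dW' c.D 1))
    (fun _ => dW'_real c.D 1) (fun _ => dW'_ne c.D 1)).CompatibleSplitting)
  (η₀ η₁ η₂ η₃ : CMAdelic (L : Type) (frameD V) × CMAdelicOne (L : Type) →* ℂˣ)
  (hmaj : ∀ k : Fin 4, HasThetaMajorants fun (p : ↥(regimeSubgroup L V.Hm) × ↥(NumberField.relNormOneIdeles (↥(maximalRealSubfield L)) L))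
      (φ : piSchwartzBruhat (↥(maximalRealSubfield L)) (Fin 3)) => lineRepOf V c.D hGR hGR₀ hGR₁ hGR₂ hGR₃ η₀ η₁ η₂ η₃ k p φ)
  (hrat : ∀ k : Fin 4, ∀ γ ∈ (V.latticeModel printFact_unitaryCompact_holds).Γ,
      ∀ t ∈ NumberField.relNormOneRat (↥(maximalRealSubfield L)) L,
        lineRepOf V c.D hGR hGR₀ hGR₁ hGR₂ hGR₃ η₀ η₁ η₂ η₃ k (γ, t) ∈ thetaStabilizerEnd (↥(maximalRealSubfield L)) (Fin 3))
  (h₁W : (∀ j, 0 < (ι₁ (dW c.D j)).re) ∨ ∀ j, (ι₁ (dW c.D j)).re < 0)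
  (A : ∀ k : Fin 4, ArchLineInput V (lineRepOf V c.D hGR hGR₀ hGR₁ hGR₂ hGR₃ η₀ η₁ η₂ η₃ k))
  (hV : IsAnisotropic L V.Hm) (N : ℕ) (Γ₀ : Level V)
  (hlevel : ∀ δ ∈ levelImage hHD hI h₁ h₃ Γ₀ hV, ∃ x : (V.latticeModel printFact_unitaryCompact_holds).G,
    x ∈ (satLevelRegimeOf V hV Γ₀.K : Subgroup (V.latticeModel printFact_unitaryCompact_holds).G) ∧
      (archSideOfChar V c hGR hGR₀ hGR₁ hGR₂ hGR₃ η₀ η₁ η₂ η₃ hmaj hrat A).ιinf δ * x ∈ (V.latticeModel printFact_unitaryCompact_holds).Γ)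
  (Φ₂ : SchwartzMap ((Fin 3 × {v : {v : InfinitePlace ↥(maximalRealSubfield L) // v.IsReal} // v ≠ cmPlace (L : Type) ι₁}) → ℝ) ℂ)


/-! ### line 2 at the exponent of record -/

section TwoRec

/-- the four sign facts of line 2 at the pin, bundled as binder-2's `hsign`. -/
theorem lineSign_two :
    (∃ i₀ : Fin 3, (∀ i, i ≠ i₀ → 0 < (ι₁ (frameD V i)).re) ∨ ∀ i, i ≠ i₀ → (ι₁ (frameD V i)).re < 0) ∧
    ((∀ j, 0 < (ι₁ (lineVec (L : Type) (dW' c.D 0) j)).re) ∨ ∀ j, (ι₁ (lineVec (L : Type) (dW' c.D 0) j)).re < 0) ∧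
    (∀ τ : (L : Type) →+* ℂ, InfinitePlace.mk τ ≠ InfinitePlace.mk ι₁ →
      (∀ i, 0 < (τ (frameD V i)).re) ∨ ∀ i, (τ (frameD V i)).re < 0) ∧
    (∀ τ : (L : Type) →+* ℂ, InfinitePlace.mk τ ≠ InfinitePlace.mk ι₁ →
      (∃ j₀ : Fin 1, ∀ j, j ≠ j₀ → 0 < (τ (lineVec (L : Type) (dW' c.D 0) j)).re) ∨ ∀ j, (τ (lineVec (L : Type) (dW' c.D 0) j)).re < 0) :=
  ⟨frameD_sign_ι₁' V, line_hs₁W_of_real (dW'_real c.D 0) (dW'_ne c.D 0), frameD_sign_of_ne V, fun τ hτ => line_hsW (dW' c.D 0) τ hτ⟩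

variable
  (eR : PosIdx (cmXW (L : Type) (frameD V) (lineVec (L : Type) (dW' c.D 0)) (fun _ => dW'_real c.D 0) ι₁ (cmPlace (L : Type) ι₁)) ≃ Unit)
  (eS : NegIdx (cmXW (L : Type) (frameD V) (lineVec (L : Type) (dW' c.D 0)) (fun _ => dW'_real c.D 0) ι₁ (cmPlace (L : Type) ι₁)) ≃ Empty)

/-- **THE VACUUM EXPONENT TUPLE OF RECORD of line 2 at `v₁`** in the literal slot: binder-2's `placeVacExponents` at
`(eP, eQ, eR, eS) = (blockPosEquiv V, blockNegEquiv V, eR, eS)`, its `hsign`/`hslot` inputs DISCHARGED (`lineSign_two`, theta-1's slot datum). -/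
def lineVacExponentsTwo : VacExponents :=
  placeVacExponents (L : Type) e₁ (frameD V) (frameD_real V) (frameD_ne V) (lineVec (L : Type) (dW' c.D 0)) (fun _ => dW'_real c.D 0)
    (fun _ => dW'_ne c.D 0) hGR₂ ι₁ (cmPlace (L : Type) ι₁) (blockPosEquiv V) (blockNegEquiv V) eR eS (lineSign_two V c)
    (exists_isArchWeilDatum_lineSlot (R := Unit) (S := Empty))

/-- its `V`-side difference is `1` (`|Unit| − |Empty|`): `e_P − e_Q = 1`. -/
theorem lineVacExponentsTwo_eP_sub_eQ :
    (lineVacExponentsTwo V c hGR₂ eR eS).eP - (lineVacExponentsTwo V c hGR₂ eR eS).eQ = 1 := by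
  have h := placeVacExponents_eP_sub_eQ (L : Type) e₁ (frameD V) (frameD_real V) (frameD_ne V)
    (lineVec (L : Type) (dW' c.D 0)) (fun _ => dW'_real c.D 0) (fun _ => dW'_ne c.D 0) hGR₂ ι₁ (cmPlace (L : Type) ι₁) (blockPosEquiv V)
    (blockNegEquiv V) eR eS (lineSign_two V c) (exists_isArchWeilDatum_lineSlot (R := Unit) (S := Empty)) (0 : Fin 2) ()
  simpa [lineVacExponentsTwo] using h

/-- (K) for line 2 at the tuple of record (binder-2 `cmBlockRepAt_κ_tensorPi_placeVacExponents`). -/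
theorem cmBlockRepAt_κ_tensorPi_lineVacExponentsTwo (kk : DPK (Fin 2) Unit Unit Empty)
    (Φ : SchwartzMap (DPIdx (Fin 2) Unit Unit Empty → ℝ) ℂ)
    (Φ₂' : SchwartzMap ((Fin 3 × {v : {v : InfinitePlace ↥(maximalRealSubfield L) // v.IsReal} // v ≠ cmPlace (L : Type) ι₁}) → ℝ) ℂ) :
    cmBlockRepAt (L : Type) e₁ (frameD V) (frameD_real V) (frameD_ne V) (lineVec (L : Type) (dW' c.D 0)) (fun _ => dW'_real c.D 0)
        (fun _ => dW'_ne c.D 0) hGR₂ ι₁ (cmPlace (L : Type) ι₁) (blockPosEquiv V) (blockNegEquiv V) eR eS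
        (cmBlockSectionAt (L : Type) (frameD V) (frameD_real V) (frameD_ne V) (lineVec (L : Type) (dW' c.D 0)) (fun _ => dW'_real c.D 0)
          (fun _ => dW'_ne c.D 0) ι₁ (cmPlace (L : Type) ι₁) (blockPosEquiv V) (blockNegEquiv V) eR eS (κ _ _ _ _ kk)) (tensorPi Φ Φ₂') =
      tensorPi (κOp _ _ (lineVacExponentsTwo V c hGR₂ eR eS) kk Φ) Φ₂' :=
  cmBlockRepAt_κ_tensorPi_placeVacExponents (L : Type) e₁ (frameD V) (frameD_real V) (frameD_ne V)
    (lineVec (L : Type) (dW' c.D 0)) (fun _ => dW'_real c.D 0) (fun _ => dW'_ne c.D 0) hGR₂ ι₁ (cmPlace (L : Type) ι₁) (blockPosEquiv V)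
    (blockNegEquiv V) eR eS (lineSign_two V c) (exists_isArchWeilDatum_lineSlot (R := Unit) (S := Empty)) kk Φ Φ₂'

variable
  (ℓ₀ : Module.Dual ℂ (Fin 2 → ℂ))
  (arch₀ : blockFamilyOfAt (L : Type) e₁ (frameD V) (frameD_real V) (frameD_ne V) (lineVec (L : Type) (dW' c.D 0))
      (fun _ => dW'_real c.D 0) (fun _ => dW'_ne c.D 0) ι₁ (blockPosEquiv V) (blockNegEquiv V) eR eS (degOnePDual Empty) Φ₂ ℓ₀ =
    (A 2).Φinf)
  (harch : ∀ a : UnitaryGroup.arch (↥(maximalRealSubfield L)) L (IsCMField.complexConj L) 3 V.Hm,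
    UnitaryGroup.archAt (↥(maximalRealSubfield L)) L (IsCMField.complexConj L) 3 V.Hm (UnitaryGroup.cmPlace (L : Type) ι₁)
        (NumberField.complexConj_smul_infinitePlace (L : Type) _) (IsCMField.complexConj_ne_one (L : Type)) a = 1 →
    ∀ ℓ, ((archSideOfChar V c hGR hGR₀ hGR₁ hGR₂ hGR₃ η₀ η₁ η₂ η₃ hmaj hrat A).P 2).ω
        (HodgeCM.Adelic.regimeEquiv L V.Hm hV
          (UnitaryGroup.archToAdelic (↥(maximalRealSubfield L)) L (IsCMField.complexConj L) 3 V.Hm a), 1)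
        (testFun (↥(maximalRealSubfield L)) (Fin 3)
          (blockFamilyOfAt (L : Type) e₁ (frameD V) (frameD_real V) (frameD_ne V) (lineVec (L : Type) (dW' c.D 0))
            (fun _ => dW'_real c.D 0) (fun _ => dW'_ne c.D 0) ι₁ (blockPosEquiv V) (blockNegEquiv V) eR eS (degOnePDual Empty) Φ₂ ℓ)
          (A 2).x₀ N) =
      testFun (↥(maximalRealSubfield L)) (Fin 3)
        (blockFamilyOfAt (L : Type) e₁ (frameD V) (frameD_real V) (frameD_ne V) (lineVec (L : Type) (dW' c.D 0))
          (fun _ => dW'_real c.D 0) (fun _ => dW'_ne c.D 0) ι₁ (blockPosEquiv V) (blockNegEquiv V) eR eS (degOnePDual Empty) Φ₂ ℓ) (A 2).x₀ N)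
  (hfin : ∀ kf : UnitaryGroup.finAdelic (↥(maximalRealSubfield L)) L (IsCMField.complexConj L) 3 V.Hm, kf ∈ Γ₀.K →
    ∀ Φinf : 𝓢((Fin 3 → mixedSpace (↥(maximalRealSubfield L))), ℂ),
      ((archSideOfChar V c hGR hGR₀ hGR₁ hGR₂ hGR₃ η₀ η₁ η₂ η₃ hmaj hrat A).P 2).ω
          (HodgeCM.Adelic.regimeEquiv L V.Hm hV
            (UnitaryGroup.finAdelicToAdelic (↥(maximalRealSubfield L)) L (IsCMField.complexConj L) 3 V.Hm kf), 1)
          (testFun (↥(maximalRealSubfield L)) (Fin 3) Φinf (A 2).x₀ N) =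
        testFun (↥(maximalRealSubfield L)) (Fin 3) Φinf (A 2).x₀ N)
  (hsec : ∀ u : stabilizer U21 x₀,
    cmBlockSectionAt (L : Type) (frameD V) (frameD_real V) (frameD_ne V) (lineVec (L : Type) (dW' c.D 0)) (fun _ => dW'_real c.D 0)
        (fun _ => dW'_ne c.D 0) ι₁ (cmPlace (L : Type) ι₁) (blockPosEquiv V) (blockNegEquiv V) eR eS (u21FrameEquiv (u : U21), 1) =
      (archSectionFrameOf V u, 1))
  (hχ : ∀ u : stabilizer U21 x₀,
    ((lineScalar_two V c.D hGR hGR₂ hGR₃ η₂ (u : U21) : ℂˣ) : ℂ) *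
        ((matA (stabilizerEquivK21.symm u)).det ^ (lineVacExponentsTwo V c hGR₂ eR eS).eP *
          sclD (stabilizerEquivK21.symm u) ^ (lineVacExponentsTwo V c hGR₂ eR eS).eQ) =
      star (sclD (stabilizerEquivK21.symm u)))


/-- **ROW 12 FOR LINE 2 IN THE LITERAL SLOT AT THE EXPONENT OF RECORD** — (K) discharged; inputs {`hlevel`, `arch₀`, `harch`, `hfin`,
`hsec`, `hχ`} + the positivity data `eR eS`. -/
def archKTypeOfSlotTwoRecG :
    ArchKTypeData (thetaSpaceInputIn hHD hI h₁ h₃ (archSideOfChar V c hGR hGR₀ hGR₁ hGR₂ hGR₃ η₀ η₁ η₂ η₃ hmaj hrat A) hV) 2 N :=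
  archKTypeOfSlotTwoG hHD hI h₁ h₃ V c hGR hGR₀ hGR₁ hGR₂ hGR₃ η₀ η₁ η₂ η₃ hmaj hrat A hV N Γ₀ hlevel Φ₂ eR eS ℓ₀ arch₀ harch hfin hsec
    (fun kk Φ => cmBlockRepAt_κ_tensorPi_lineVacExponentsTwo V c hGR₂ eR eS kk Φ Φ₂) hχ

/-- row 14 for it (no further hypothesis). -/
theorem isWeaklyPDiff_archKTypeOfSlotTwoRecG :
    (archKTypeOfSlotTwoRecG hHD hI h₁ h₃ V c hGR hGR₀ hGR₁ hGR₂ hGR₃ η₀ η₁ η₂ η₃ hmaj hrat A hV N Γ₀ hlevel Φ₂ eR eS ℓ₀ arch₀ harch hfin hsec hχ).IsWeaklyPDiff BallForms.expP :=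
  isWeaklyPDiff_archKTypeOfSlotTwoG hHD hI h₁ h₃ V c hGR hGR₀ hGR₁ hGR₂ hGR₃ η₀ η₁ η₂ η₃ hmaj hrat A hV N Γ₀ hlevel Φ₂ eR eS ℓ₀ arch₀ harch hfin hsec _ hχ

/-- row 15 for it along `twistU21 ∘ expP` (no further hypothesis). -/
theorem isPMinusKilledAlong_archKTypeOfSlotTwoRec_twistG (p : Fin 2) :
    (archKTypeOfSlotTwoRecG hHD hI h₁ h₃ V c hGR hGR₀ hGR₁ hGR₂ hGR₃ η₀ η₁ η₂ η₃ hmaj hrat A hV N Γ₀ hlevel Φ₂ eR eS ℓ₀ arch₀ harch hfin hsec hχ).IsPMinusKilledAlong (fun b => twistU21 L ι₁ (BallForms.expP b))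
      (-Complex.I • (Pi.single p 1 : Fin 2 → ℂ)) :=
  isPMinusKilledAlong_archKTypeOfSlotTwo_twistG hHD hI h₁ h₃ V c hGR hGR₀ hGR₁ hGR₂ hGR₃ η₀ η₁ η₂ η₃ hmaj hrat A hV N Γ₀ hlevel Φ₂ eR eS ℓ₀ arch₀ harch hfin hsec _ hχ p


/-- **row 15 ALONG `expP` ITSELF in the branch `(mk ι₁).embedding = ι₁`** (there `twistU21 = id`; the other branch is the (TWIST-2) item). -/
theorem isPMinusKilledAlong_archKTypeOfSlotTwoRec_of_embedding_eqG (h : (InfinitePlace.mk ι₁).embedding = ι₁) (p : Fin 2) :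
    (archKTypeOfSlotTwoRecG hHD hI h₁ h₃ V c hGR hGR₀ hGR₁ hGR₂ hGR₃ η₀ η₁ η₂ η₃ hmaj hrat A hV N Γ₀ hlevel Φ₂ eR eS ℓ₀ arch₀ harch hfin hsec hχ).IsPMinusKilledAlong BallForms.expP
      (-Complex.I • (Pi.single p 1 : Fin 2 → ℂ)) := by
  have e : (fun b => twistU21 L ι₁ (BallForms.expP b)) = BallForms.expP := funext fun b => twistU21_eq_self_of_embedding_eq h _
  rw [← e]
  exact isPMinusKilledAlong_archKTypeOfSlotTwoRec_twistG hHD hI h₁ h₃ V c hGR hGR₀ hGR₁ hGR₂ hGR₃ η₀ η₁ η₂ η₃ hmaj hrat A hV N Γ₀ hlevel Φ₂ eR eS ℓ₀ arch₀ harch hfin hsec hχ p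

end TwoRec

/-! ### line 3 at the exponent of record -/

section ThreeRec

/-- the four sign facts of line 3 at the pin, bundled as binder-2's `hsign`. -/
theorem lineSign_three :
    (∃ i₀ : Fin 3, (∀ i, i ≠ i₀ → 0 < (ι₁ (frameD V i)).re) ∨ ∀ i, i ≠ i₀ → (ι₁ (frameD V i)).re < 0) ∧
    ((∀ j, 0 < (ι₁ (lineVec (L : Type) (dW' c.D 1) j)).re) ∨ ∀ j, (ι₁ (lineVec (L : Type) (dW' c.D 1) j)).re < 0) ∧
    (∀ τ : (L : Type) →+* ℂ, InfinitePlace.mk τ ≠ InfinitePlace.mk ι₁ →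
      (∀ i, 0 < (τ (frameD V i)).re) ∨ ∀ i, (τ (frameD V i)).re < 0) ∧
    (∀ τ : (L : Type) →+* ℂ, InfinitePlace.mk τ ≠ InfinitePlace.mk ι₁ →
      (∃ j₀ : Fin 1, ∀ j, j ≠ j₀ → 0 < (τ (lineVec (L : Type) (dW' c.D 1) j)).re) ∨ ∀ j, (τ (lineVec (L : Type) (dW' c.D 1) j)).re < 0) :=
  ⟨frameD_sign_ι₁' V, line_hs₁W_of_real (dW'_real c.D 1) (dW'_ne c.D 1), frameD_sign_of_ne V, fun τ hτ => line_hsW (dW' c.D 1) τ hτ⟩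

variable
  (eR : PosIdx (cmXW (L : Type) (frameD V) (lineVec (L : Type) (dW' c.D 1)) (fun _ => dW'_real c.D 1) ι₁ (cmPlace (L : Type) ι₁)) ≃ Unit)
  (eS : NegIdx (cmXW (L : Type) (frameD V) (lineVec (L : Type) (dW' c.D 1)) (fun _ => dW'_real c.D 1) ι₁ (cmPlace (L : Type) ι₁)) ≃ Empty)

/-- **THE VACUUM EXPONENT TUPLE OF RECORD of line 3 at `v₁`** in the literal slot: binder-2's `placeVacExponents` at
`(eP, eQ, eR, eS) = (blockPosEquiv V, blockNegEquiv V, eR, eS)`, its `hsign`/`hslot` inputs DISCHARGED (`lineSign_three`, theta-1's slot datum). -/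
def lineVacExponentsThree : VacExponents :=
  placeVacExponents (L : Type) e₁ (frameD V) (frameD_real V) (frameD_ne V) (lineVec (L : Type) (dW' c.D 1)) (fun _ => dW'_real c.D 1)
    (fun _ => dW'_ne c.D 1) hGR₃ ι₁ (cmPlace (L : Type) ι₁) (blockPosEquiv V) (blockNegEquiv V) eR eS (lineSign_three V c)
    (exists_isArchWeilDatum_lineSlot (R := Unit) (S := Empty))

/-- its `V`-side difference is `1` (`|Unit| − |Empty|`): `e_P − e_Q = 1`. -/
theorem lineVacExponentsThree_eP_sub_eQ :
    (lineVacExponentsThree V c hGR₃ eR eS).eP - (lineVacExponentsThree V c hGR₃ eR eS).eQ = 1 := by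
  have h := placeVacExponents_eP_sub_eQ (L : Type) e₁ (frameD V) (frameD_real V) (frameD_ne V)
    (lineVec (L : Type) (dW' c.D 1)) (fun _ => dW'_real c.D 1) (fun _ => dW'_ne c.D 1) hGR₃ ι₁ (cmPlace (L : Type) ι₁) (blockPosEquiv V)
    (blockNegEquiv V) eR eS (lineSign_three V c) (exists_isArchWeilDatum_lineSlot (R := Unit) (S := Empty)) (0 : Fin 2) ()
  simpa [lineVacExponentsThree] using h

/-- (K) for line 3 at the tuple of record (binder-2 `cmBlockRepAt_κ_tensorPi_placeVacExponents`). -/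
theorem cmBlockRepAt_κ_tensorPi_lineVacExponentsThree (kk : DPK (Fin 2) Unit Unit Empty)
    (Φ : SchwartzMap (DPIdx (Fin 2) Unit Unit Empty → ℝ) ℂ)
    (Φ₂' : SchwartzMap ((Fin 3 × {v : {v : InfinitePlace ↥(maximalRealSubfield L) // v.IsReal} // v ≠ cmPlace (L : Type) ι₁}) → ℝ) ℂ) :
    cmBlockRepAt (L : Type) e₁ (frameD V) (frameD_real V) (frameD_ne V) (lineVec (L : Type) (dW' c.D 1)) (fun _ => dW'_real c.D 1)
        (fun _ => dW'_ne c.D 1) hGR₃ ι₁ (cmPlace (L : Type) ι₁) (blockPosEquiv V) (blockNegEquiv V) eR eS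
        (cmBlockSectionAt (L : Type) (frameD V) (frameD_real V) (frameD_ne V) (lineVec (L : Type) (dW' c.D 1)) (fun _ => dW'_real c.D 1)
          (fun _ => dW'_ne c.D 1) ι₁ (cmPlace (L : Type) ι₁) (blockPosEquiv V) (blockNegEquiv V) eR eS (κ _ _ _ _ kk)) (tensorPi Φ Φ₂') =
      tensorPi (κOp _ _ (lineVacExponentsThree V c hGR₃ eR eS) kk Φ) Φ₂' :=
  cmBlockRepAt_κ_tensorPi_placeVacExponents (L : Type) e₁ (frameD V) (frameD_real V) (frameD_ne V)
    (lineVec (L : Type) (dW' c.D 1)) (fun _ => dW'_real c.D 1) (fun _ => dW'_ne c.D 1) hGR₃ ι₁ (cmPlace (L : Type) ι₁) (blockPosEquiv V)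
    (blockNegEquiv V) eR eS (lineSign_three V c) (exists_isArchWeilDatum_lineSlot (R := Unit) (S := Empty)) kk Φ Φ₂'

variable
  (ℓ₀ : Module.Dual ℂ (Fin 2 → ℂ))
  (arch₀ : blockFamilyOfAt (L : Type) e₁ (frameD V) (frameD_real V) (frameD_ne V) (lineVec (L : Type) (dW' c.D 1))
      (fun _ => dW'_real c.D 1) (fun _ => dW'_ne c.D 1) ι₁ (blockPosEquiv V) (blockNegEquiv V) eR eS (degOnePDual Empty) Φ₂ ℓ₀ =
    (A 3).Φinf)
  (harch : ∀ a : UnitaryGroup.arch (↥(maximalRealSubfield L)) L (IsCMField.complexConj L) 3 V.Hm,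
    UnitaryGroup.archAt (↥(maximalRealSubfield L)) L (IsCMField.complexConj L) 3 V.Hm (UnitaryGroup.cmPlace (L : Type) ι₁)
        (NumberField.complexConj_smul_infinitePlace (L : Type) _) (IsCMField.complexConj_ne_one (L : Type)) a = 1 →
    ∀ ℓ, ((archSideOfChar V c hGR hGR₀ hGR₁ hGR₂ hGR₃ η₀ η₁ η₂ η₃ hmaj hrat A).P 3).ω
        (HodgeCM.Adelic.regimeEquiv L V.Hm hV
          (UnitaryGroup.archToAdelic (↥(maximalRealSubfield L)) L (IsCMField.complexConj L) 3 V.Hm a), 1)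
        (testFun (↥(maximalRealSubfield L)) (Fin 3)
          (blockFamilyOfAt (L : Type) e₁ (frameD V) (frameD_real V) (frameD_ne V) (lineVec (L : Type) (dW' c.D 1))
            (fun _ => dW'_real c.D 1) (fun _ => dW'_ne c.D 1) ι₁ (blockPosEquiv V) (blockNegEquiv V) eR eS (degOnePDual Empty) Φ₂ ℓ)
          (A 3).x₀ N) =
      testFun (↥(maximalRealSubfield L)) (Fin 3)
        (blockFamilyOfAt (L : Type) e₁ (frameD V) (frameD_real V) (frameD_ne V) (lineVec (L : Type) (dW' c.D 1))
          (fun _ => dW'_real c.D 1) (fun _ => dW'_ne c.D 1) ι₁ (blockPosEquiv V) (blockNegEquiv V) eR eS (degOnePDual Empty) Φ₂ ℓ) (A 3).x₀ N)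
  (hfin : ∀ kf : UnitaryGroup.finAdelic (↥(maximalRealSubfield L)) L (IsCMField.complexConj L) 3 V.Hm, kf ∈ Γ₀.K →
    ∀ Φinf : 𝓢((Fin 3 → mixedSpace (↥(maximalRealSubfield L))), ℂ),
      ((archSideOfChar V c hGR hGR₀ hGR₁ hGR₂ hGR₃ η₀ η₁ η₂ η₃ hmaj hrat A).P 3).ω
          (HodgeCM.Adelic.regimeEquiv L V.Hm hV
            (UnitaryGroup.finAdelicToAdelic (↥(maximalRealSubfield L)) L (IsCMField.complexConj L) 3 V.Hm kf), 1)
          (testFun (↥(maximalRealSubfield L)) (Fin 3) Φinf (A 3).x₀ N) =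
        testFun (↥(maximalRealSubfield L)) (Fin 3) Φinf (A 3).x₀ N)
  (hsec : ∀ u : stabilizer U21 x₀,
    cmBlockSectionAt (L : Type) (frameD V) (frameD_real V) (frameD_ne V) (lineVec (L : Type) (dW' c.D 1)) (fun _ => dW'_real c.D 1)
        (fun _ => dW'_ne c.D 1) ι₁ (cmPlace (L : Type) ι₁) (blockPosEquiv V) (blockNegEquiv V) eR eS (u21FrameEquiv (u : U21), 1) =
      (archSectionFrameOf V u, 1))
  (hχ : ∀ u : stabilizer U21 x₀,
    ((lineScalar_three V c.D hGR hGR₂ hGR₃ η₃ (u : U21) : ℂˣ) : ℂ) *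
        ((matA (stabilizerEquivK21.symm u)).det ^ (lineVacExponentsThree V c hGR₃ eR eS).eP *
          sclD (stabilizerEquivK21.symm u) ^ (lineVacExponentsThree V c hGR₃ eR eS).eQ) =
      star (sclD (stabilizerEquivK21.symm u)))


/-- **ROW 12 FOR LINE 3 IN THE LITERAL SLOT AT THE EXPONENT OF RECORD** — (K) discharged; inputs {`hlevel`, `arch₀`, `harch`, `hfin`,
`hsec`, `hχ`} + the positivity data `eR eS`. -/
def archKTypeOfSlotThreeRecG :
    ArchKTypeData (thetaSpaceInputIn hHD hI h₁ h₃ (archSideOfChar V c hGR hGR₀ hGR₁ hGR₂ hGR₃ η₀ η₁ η₂ η₃ hmaj hrat A) hV) 3 N :=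
  archKTypeOfSlotThreeG hHD hI h₁ h₃ V c hGR hGR₀ hGR₁ hGR₂ hGR₃ η₀ η₁ η₂ η₃ hmaj hrat A hV N Γ₀ hlevel Φ₂ eR eS ℓ₀ arch₀ harch hfin hsec
    (fun kk Φ => cmBlockRepAt_κ_tensorPi_lineVacExponentsThree V c hGR₃ eR eS kk Φ Φ₂) hχ

/-- row 14 for it (no further hypothesis). -/
theorem isWeaklyPDiff_archKTypeOfSlotThreeRecG :
    (archKTypeOfSlotThreeRecG hHD hI h₁ h₃ V c hGR hGR₀ hGR₁ hGR₂ hGR₃ η₀ η₁ η₂ η₃ hmaj hrat A hV N Γ₀ hlevel Φ₂ eR eS ℓ₀ arch₀ harch hfin hsec hχ).IsWeaklyPDiff BallForms.expP :=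
  isWeaklyPDiff_archKTypeOfSlotThreeG hHD hI h₁ h₃ V c hGR hGR₀ hGR₁ hGR₂ hGR₃ η₀ η₁ η₂ η₃ hmaj hrat A hV N Γ₀ hlevel Φ₂ eR eS ℓ₀ arch₀ harch hfin hsec _ hχ

/-- row 15 for it along `twistU21 ∘ expP` (no further hypothesis). -/
theorem isPMinusKilledAlong_archKTypeOfSlotThreeRec_twistG (p : Fin 2) :
    (archKTypeOfSlotThreeRecG hHD hI h₁ h₃ V c hGR hGR₀ hGR₁ hGR₂ hGR₃ η₀ η₁ η₂ η₃ hmaj hrat A hV N Γ₀ hlevel Φ₂ eR eS ℓ₀ arch₀ harch hfin hsec hχ).IsPMinusKilledAlong (fun b => twistU21 L ι₁ (BallForms.expP b))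
      (-Complex.I • (Pi.single p 1 : Fin 2 → ℂ)) :=
  isPMinusKilledAlong_archKTypeOfSlotThree_twistG hHD hI h₁ h₃ V c hGR hGR₀ hGR₁ hGR₂ hGR₃ η₀ η₁ η₂ η₃ hmaj hrat A hV N Γ₀ hlevel Φ₂ eR eS ℓ₀ arch₀ harch hfin hsec _ hχ p


/-- **row 15 ALONG `expP` ITSELF in the branch `(mk ι₁).embedding = ι₁`** (there `twistU21 = id`; the other branch is the (TWIST-2) item). -/
theorem isPMinusKilledAlong_archKTypeOfSlotThreeRec_of_embedding_eqG (h : (InfinitePlace.mk ι₁).embedding = ι₁) (p : Fin 2) :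
    (archKTypeOfSlotThreeRecG hHD hI h₁ h₃ V c hGR hGR₀ hGR₁ hGR₂ hGR₃ η₀ η₁ η₂ η₃ hmaj hrat A hV N Γ₀ hlevel Φ₂ eR eS ℓ₀ arch₀ harch hfin hsec hχ).IsPMinusKilledAlong BallForms.expP
      (-Complex.I • (Pi.single p 1 : Fin 2 → ℂ)) := by
  have e : (fun b => twistU21 L ι₁ (BallForms.expP b)) = BallForms.expP := funext fun b => twistU21_eq_self_of_embedding_eq h _
  rw [← e]
  exact isPMinusKilledAlong_archKTypeOfSlotThreeRec_twistG hHD hI h₁ h₃ V c hGR hGR₀ hGR₁ hGR₂ hGR₃ η₀ η₁ η₂ η₃ hmaj hrat A hV N Γ₀ hlevel Φ₂ eR eS ℓ₀ arch₀ harch hfin hsec hχ p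

end ThreeRec

end Record

end HodgeCM.Model

end
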